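import Mathlib

/-!
# P6KoszulKubert21 — kernel certificates at the level N = 21 = 3 · 7 of the three theorems of
proofs/P6-SignCohomologyCount-v1.md (p6 (g17); the sibling v1.1 carries the wording of record):
THEOREM K1 (the Koszul complex K_•(N) of the distribution relations is a free resolution of the unpunctured universal ordinary
distribution U_N, which is ℤ-free of rank φ(N) = 12 on the digit basis B_N), THEOREM K2 (the C_2-structure of U_N under
ι = (x ↦ −x): U_N ≅ ℤ_+^a ⊕ ℤ_−^b ⊕ ℤ[C_2]^c with (a, b, c) = (2, 2, 4), a = b = 2^{#P(N)−1}, hence Ĥ^0(C_2, U_N) ≅ F_2^a and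
Ĥ^{−1}(C_2, U_N) ≅ F_2^b, with the zigzag classes u_S of Lemma 3.2 a basis of each), and THEOREM C (dim_{F_2} D_N = φ(N)/2 +
2^{#P(N)−1} − 1 = 7 for the space D_N of even F_2-valued ordinary distributions of level N punctured at 0).
p6 (g18), 2026-08-29.  Record-only: supporting, never frozen; nothing here bears on the Hodge conjecture at any degree, on
S13 / S0 or the residual of record.

THE OBJECTS ARE DEFINED HERE FROM THE NOTE'S FORMULAS (§1.1).  Ω_S = {a ∈ ℤ/N : n_S | a}, a point indexed by j = a/n_S
(0 ≤ j < m_S := N/n_S); the basis of K_k = ⊕_{|S|=k} ℤ[Ω_S] is the list of the (S, j), S over the k-subsets of the primes in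
lexicographic order; φ_p([j]_S) = [p·j]_{S∖p} − Σ_{k<p} [j + k·m_S]_{S∖p} (the point p·x, and the p points y with p·y = x);
∂[x]_S = Σ_i (−1)^i φ_{p_i}([x]) over S = {p_0 < ⋯ < p_{k−1}}; the digit basis B_N = {x : a_p(x) < φ(p^{e_p}) for every p} with
a_p(x) = x·(N/p^{e_p})^{−1} mod p^{e_p}; ι[j]_S = [(m_S − j) mod m_S]_S; e_S = [0]_S, or [0]_S + [1/2]_S when 4 | N and 2 ∈ S;
P(N) = the primes of N with 2 removed when 2 ∥ N; D_N ⊂ F_2^{Ω_N ∖ 0} is cut out by f(−x) = f(x), f(1/2) = 0 (N even) and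
f(z) = Σ_{py=z} f(y) for p | N and z ∈ pΩ_N ∖ {0, 1/2}.

THE ENCODING (the only device): an integer vector v ∈ ℤ^n is a pair (P, Q) of natural numbers with v_i = digit_i(P) − digit_i(Q),
digit_i(X) = (X >>> 64·i) &&& (2^64 − 1), together with a list of positions containing its support (a column = `Col`).  Then v + w
is the digit-wise sum when no digit reaches 2^64, c·v for c = c⁺ − c⁻ is (c⁺P + c⁻Q, c⁺Q + c⁻P), v = e_x reads P = Q + 2^{64x},
v = w reads P + Q_w = Q + P_w, and a permutation of the positions acts digit by digit.  Products Σ_i v_i·col_i run over the listed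
support of v (a position outside the list has digit 0 in P and in Q — `chk_supports` checks this for every datum).
NO-OVERFLOW LEMMA: every digit of every datum, of every ∂-column and of every u_S is < 2^20 (`chk_bounds`, kernel-checked) and
every sum below has at most 21 + 1 terms, each a product of two such digits, so every digit of every intermediate value is
< (21 + 1)·2^40 < 2^64 and no carry ever crosses a digit: the Nat identities checked below are digit-wise identities of
integer vectors.  E, M, W⁻¹ and u_S are kept in the EMBEDDED form (codes of length N supported on the digit-basis points), W's
columns are listed by the point, so that s (the inclusion of the basis points) is the identity on codes.  A matrix is a balanced
binary tree of its columns (`Tr`), the column i reached by the bits of i.  (Witnesses computed outside Lean by the deposited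
scripts; everything below is checked by the kernel.)

WHAT THE CHECKS MEAN.  With s : ℤ^{B_N} → K_0 the inclusion of the basis points and E : K_0 → ℤ^{B_N} the coordinate map:
(i) E∂_1 = 0, (ii) sE + ∂_1h_0 = 1 on K_0, (iii) Es = 1, (iv) h_{k−1}∂_k + ∂_{k+1}h_k = 1 on K_k (1 ≤ k < r) and h_{r−1}∂_r = 1 on K_r
give: ker ∂_k = im ∂_{k+1} for k ≥ 1 (v = ∂_{k+1}(h_k v) when ∂_k v = 0), ∂_r injective, and s̄ : ℤ^{B_N} → U_N = K_0/∂_1K_1 an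
isomorphism (surjective by (ii), injective by (i) + (iii): Ē s̄ = 1) — THEOREM K1 AT N.  (v) W·W⁻¹ = 1 and W·M = D·W, M the matrix
of ι on U_N in the digit basis (its column b is E([−b])), D = diag(1^a, (−1)^b, J^c): U_N ≅ ℤ_+^a ⊕ ℤ_−^b ⊕ ℤ[C_2]^c as ℤ[C_2]-modules,
so Ĥ^0 ≅ F_2^a, Ĥ^{−1} ≅ F_2^b (Tate cohomology is additive; ℤ_+ has Ĥ^0 = F_2, Ĥ^{−1} = 0; ℤ_− the reverse; ℤ[C_2] has none).
(vi) x_k = e_S, ∂x_j = (1 + s_jι)x_{j−1} (s_j = (−1)^{k−j}) for every S ⊆ P(N), u_S := E x_0 with ιu_S = (−1)^{|S|}u_S, and the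
matrices (ℤ_+-block of W u_S mod 2)_{|S| even} and (ℤ_−-block of W u_S mod 2)_{|S| odd} invertible over F_2 — the class of an invariant
u in Ĥ^0 being the ℤ_+-block of Wu mod 2, of an anti-invariant in Ĥ^{−1} the ℤ_−-block — THEOREM K2 AT N.  (vii) ρ = 13
echelon rows, each the XOR of the constraint rows its recipe lists, with strictly decreasing leading bits (independent: rank ≥ ρ),
and every constraint row the XOR of the echelon rows its list names (rank ≤ ρ): dim D_N = (N − 1) − ρ = 7 — THEOREM C AT N.
-/

namespace HodgeRepro0.P6KoszulKubert21

/-- The code of an integer vector: (P, Q) with v_i = digit_i P − digit_i Q. -/ abbrev Code := Nat × Nat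
/-- A column: its code and a list containing its support. -/ abbrev Col := Code × List Nat
/-- A balanced binary tree of entries: the entry i is reached by the bits of i, low bit first (0 = left). -/ inductive Tr (α : Type) where
  | nil : Tr α
  | leaf : α → Tr α
  | node : Tr α → Tr α → Tr α
/-- The entry i (a default for a missing one). -/ def Tr.get {α : Type} (d : α) : Tr α → Nat → α
  | .nil, _ => d
  | .leaf c, _ => c
  | .node l r, i => if i % 2 = 0 then l.get d (i / 2) else r.get d (i / 2)
/-- The column i of a matrix. -/ def Tr.col (t : Tr Col) (i : Nat) : Col := t.get ((0, 0), []) i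
/-- The even-indexed elements. -/ def evens {α : Type} : List α → List α
  | [] => []
  | [x] => [x]
  | x :: _ :: rest => x :: evens rest
/-- The odd-indexed elements. -/ def odds {α : Type} : List α → List α
  | [] => []
  | [_] => []
  | _ :: y :: rest => y :: odds rest
/-- The tree of a list (the first argument a depth bound). -/ def Tr.ofList {α : Type} : Nat → List α → Tr α
  | _, [] => .nil
  | _, [c] => .leaf c
  | 0, c :: _ => .leaf c
  | d + 1, l => .node (Tr.ofList d (evens l)) (Tr.ofList d (odds l))
/-- The length, by a tail recursion whose accumulator is forced at every step. -/ def lenF {α : Type} : List α → Nat → Nat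
  | [], n => n
  | _ :: xs, n => match n with
    | 0 => lenF xs 1
    | k + 1 => lenF xs (k + 2)
/-- Position-indexed enumeration (indices forced at every step). -/ def enumFrom {α : Type} : Nat → List α → List (Nat × α)
  | _, [] => []
  | n, x :: xs => match n with
    | 0 => (0, x) :: enumFrom 1 xs
    | k + 1 => (k + 1, x) :: enumFrom (k + 2) xs
/-- digit_i X in base 2^64. -/ def digit (X i : Nat) : Nat := (X >>> (64 * i)) &&& 18446744073709551615
/-- 2^{64 i}, the code of e_i. -/ def mono (i : Nat) : Nat := 1 <<< (64 * i)
/-- v + w. -/ def cadd (u v : Code) : Code := (u.1 + v.1, u.2 + v.2)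
/-- v = w. -/ def ceq (u v : Code) : Bool := Nat.beq (u.1 + v.2) (u.2 + v.1)
/-- v = e_x. -/ def cunit (u : Code) (x : Nat) : Bool := Nat.beq u.1 (u.2 + mono x)
/-- v = 0. -/ def czero (u : Code) : Bool := Nat.beq u.1 u.2
/-- Σ_{i ∈ supp} v_i·col_i, the accumulators forced at every step. -/ def mulVecS (cols : Tr Col) (v : Code) : List Nat → Nat → Nat → Code
  | [], aP, aQ => (aP, aQ)
  | i :: rest, aP, aQ =>
    let p := digit v.1 i
    let q := digit v.2 i
    let c := (cols.col i).1
    match aP + p * c.1 + q * c.2, aQ + p * c.2 + q * c.1 with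
    | 0, 0 => mulVecS cols v rest 0 0
    | 0, b + 1 => mulVecS cols v rest 0 (b + 1)
    | a + 1, 0 => mulVecS cols v rest (a + 1) 0
    | a + 1, b + 1 => mulVecS cols v rest (a + 1) (b + 1)
/-- A matrix (the column i = the image of e_i) applied to a column v (its code with its support). -/ def mulVec (cols : Tr Col) (v : Col) : Code := mulVecS cols v.1 v.2 0 0
/-- Σ_{i ∈ supp} digit_i(X)·2^{64·f(i)}: the image of X under a permutation f of the positions (accumulator forced). -/ def permuteS (f : Nat → Nat) (X : Nat) : List Nat → Nat → Nat
  | [], acc => acc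
  | i :: rest, acc => match acc + digit X i * mono (f i) with
    | 0 => permuteS f X rest 0
    | a + 1 => permuteS f X rest (a + 1)
/-- A permutation f of the positions applied to a column. -/ def permute (f : Nat → Nat) (v : Col) : Col := ((permuteS f v.1.1 v.2 0, permuteS f v.1.2 v.2 0), v.2.map f)
/-- The mask with the digits 0..n−1 all equal to 2^20 − 1. -/ def maskD (n : Nat) : Nat := 1048575 * (((1 <<< (64 * n)) - 1) / 18446744073709551615)
/-- Every digit of X is < 2^20 (no bits outside the mask): X &&& maskD n = X. -/ def digitsD (X n : Nat) : Bool := Nat.beq (X &&& maskD n) X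
/-- Every digit of X outside the positions listed is 0: X &&& (the all-ones mask of the listed positions) = X. -/ def suppOK (c : Col) : Bool :=
  let m := c.2.foldl (fun acc i => acc ||| (18446744073709551615 * mono i)) 0
  Nat.beq (c.1.1 &&& m) c.1.1 && Nat.beq (c.1.2 &&& m) c.1.2
/-- The code of a sparse list of (index, coefficient). -/ def ofSparse (terms : List (Nat × Int)) : Code :=
  terms.foldl (fun acc t => if 0 < t.2 then (acc.1 + t.2.toNat * mono t.1, acc.2) else (acc.1, acc.2 + (-t.2).toNat * mono t.1)) (0, 0)
/-- The code (P, Q) from the positive entries (index, value) and the negative entries (index, |value|). -/ def ofPN (pos neg : List (Nat × Nat)) : Code :=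
  (pos.foldl (fun acc t => acc + t.2 * mono t.1) 0, neg.foldl (fun acc t => acc + t.2 * mono t.1) 0)
/-- The product of a list. -/ def prodL : List Nat → Nat
  | [] => 1
  | x :: xs => x * prodL xs
/-- Concatenated map. -/ def flatMapL {α β : Type} (f : α → List β) : List α → List β
  | [] => []
  | x :: xs => f x ++ flatMapL f xs
/-- The k-element sublists, in lexicographic order. -/ def combos : List Nat → Nat → List (List Nat)
  | _, 0 => [[]]
  | [], _ + 1 => []
  | p :: ps, k + 1 => (combos ps k).map (p :: ·) ++ combos ps (k + 1)

/-- The level N = 21 = 3 · 7. -/ def N : Nat := 21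
/-- The prime powers of N, increasing. -/ def PE : List (Nat × Nat) := [(3, 1), (7, 1)]
/-- The primes of N. -/ def P : List Nat := PE.map (·.1)
/-- (N/p^e)^{−1} mod p^e per prime (checked in `chk_setup`). -/ def invs : List Nat := [1, 5]
/-- n_S. -/ def nS (S : List Nat) : Nat := prodL S
/-- m_S = |Ω_S| = N / n_S. -/ def mS (S : List Nat) : Nat := N / nS S
/-- The basis of K_k: (S, j), S over `combos P k`, 0 ≤ j < m_S. -/ def basisK (k : Nat) : List (List Nat × Nat) := flatMapL (fun S => (List.range (mS S)).map (fun j => (S, j))) (combos P k)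
/-- dim K_k. -/ def dimK (k : Nat) : Nat := lenF (basisK k) 0
/-- The index of [j]_T among the summands listed: the offset of T plus j. -/ def idxIn : List (List Nat) → List Nat → Nat → Nat
  | [], _, j => j
  | T' :: rest, T, j => if T' = T then j else mS T' + idxIn rest T j
/-- The index of [j]_T in the basis of K_k. -/ def idx (k : Nat) (T : List Nat) (j : Nat) : Nat := idxIn (combos P k) T j
/-- The (S, j) at the index i of K_k, located by the summand sizes. -/ def locate : List (List Nat) → Nat → List Nat × Nat
  | [], i => ([], i)
  | S :: rest, i => if i < mS S then (S, i) else locate rest (i - mS S)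
/-- φ_p([j]_S) in ℤ[Ω_{S∖p}] as (index, coefficient) pairs: [p·j] − Σ_{k<p} [j + k·m_S]. -/ def phiP (S : List Nat) (p j : Nat) : List (Nat × Int) := (p * j, 1) :: (List.range p).map (fun k => (j + k * mS S, -1))
/-- The terms of ∂_k on the basis vector (S, j): Σ_i (−1)^i φ_{p_i}([j]_S) in the summand S ∖ p_i of K_{k−1}. -/ def dTerms (k : Nat) (x : List Nat × Nat) : List (Nat × Int) :=
  flatMapL (fun ip => (phiP x.1 ip.2 x.2).map (fun q => (idx (k - 1) (x.1.erase ip.2) q.1, if ip.1 % 2 = 0 then q.2 else -q.2))) (enumFrom 0 x.1)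
/-- The column of ∂_k at the basis vector (S, j), with its support. -/ def dCol (k : Nat) (x : List Nat × Nat) : Col := (ofSparse (dTerms k x), (dTerms k x).map (·.1))
/-- The columns of ∂_k. -/ def dCols (k : Nat) : List Col := (basisK k).map (dCol k)
/-- The columns of ∂_k as a tree. -/ def dTree (k : Nat) : Tr Col := Tr.ofList 24 (dCols k)
/-- The p-adic digit a_p(x) = x·(N/p^e)^{−1} mod p^e. -/ def pdigit (x : Nat) (pe : Nat × Nat) (inv : Nat) : Nat := (x * inv) % (pe.1 ^ pe.2)
/-- x ∈ B_N: every p-adic digit below φ(p^e) = p^e − p^{e−1}. -/ def inB (x : Nat) : Bool := (List.zip PE invs).all (fun q => pdigit x q.1 q.2 < q.1.1 ^ q.1.2 - q.1.1 ^ (q.1.2 - 1))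
/-- The digit basis B_N, increasing. -/ def B : List Nat := (List.range N).filter inB
/-- φ(N) by the product formula. -/ def phiN : Nat := prodL (PE.map (fun q => q.1 ^ q.2 - q.1 ^ (q.2 - 1)))
/-- ι on the index i of K_k: (S, j) ↦ (S, (m_S − j) mod m_S). -/ def iotaIdx (k : Nat) (i : Nat) : Nat :=
  let x := locate (combos P k) i
  idx k x.1 ((mS x.1 - x.2) % mS x.1)
/-- ι on a column of K_k. -/ def applyIota (k : Nat) (v : Col) : Col := permute (iotaIdx k) v
/-- e_S. -/ def eS (S : List Nat) : Code :=
  let k := S.length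
  if N % 4 = 0 ∧ S.contains 2 then (mono (idx k S 0) + mono (idx k S (mS S / 2)), 0) else (mono (idx k S 0), 0)
/-- P(N). -/ def PN : List Nat := (PE.filter (fun q => ¬ (q.1 = 2 ∧ q.2 = 1))).map (·.1)
/-- The constraint rows of D_N as bitsets over the bits 1..N−1. -/ def DNrows : List Nat :=
  ((List.range N).filter (fun x => 0 < x ∧ x < (N - x) % N)).map (fun x => (1 <<< x) ||| (1 <<< ((N - x) % N)))
  ++ (if N % 2 = 0 then [1 <<< (N / 2)] else [])
  ++ flatMapL (fun p => ((List.range (N / p)).filter (fun j => ¬ (p * j = 0) ∧ ¬ (N % 2 = 0 ∧ p * j = N / 2))).map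
        (fun j => (List.range p).foldl (fun acc k => acc ^^^ (1 <<< (j + k * (N / p)))) (1 <<< (p * j)))) P
/-- XOR of the listed entries of a tree of bitsets onto an accumulator (forced at every step). -/ def xorList (t : Tr Nat) : List Nat → Nat → Nat
  | [], acc => acc
  | i :: rest, acc => match acc ^^^ t.get 0 i with
    | 0 => xorList t rest 0
    | a + 1 => xorList t rest (a + 1)
/-- The pivot bit is the leading bit of the row: the bit is set and nothing lies above it. -/ def pivotOK (rp : Nat × Nat) : Bool := rp.1.testBit rp.2 && Nat.beq (rp.1 >>> (rp.2 + 1)) 0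
/-- Strictly decreasing. -/ def strictDesc : List Nat → Bool
  | [] => true
  | [_] => true
  | x :: y :: rest => (y < x) && strictDesc (y :: rest)

/-! ## The witnesses (data: trees of columns, each given by its positive entries (position, value) and its negative
entries (position, |value|) — its code is `ofPN` of them — together with its support) -/

/-- The columns ≡ 0 (mod 4) of `E`. -/ def E_c0 : Tr Col := (.node (.node (.node (.leaf (ofPN [(0, 1)] [], [0])) (.leaf (ofPN [(16, 1)] [], [16]))) (.leaf (ofPN [(3, 1)] [(1, 1), (15, 1)], [1, 3, 15]))) (.node (.node (.leaf (ofPN [] [(1, 1), (10, 1), (13, 1), (16, 1), (19, 1)], [1, 10, 13, 16, 19])) (.leaf (ofPN [] [(3, 1), (6, 2), (9, 1), (12, 1), (13, 1), (15, 1)], [3, 6, 9, 12, 13, 15]))) (.leaf (ofPN [(12, 1)] [], [12]))))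
/-- The columns ≡ 1 (mod 4) of `E`. -/ def E_c1 : Tr Col := (.node (.node (.node (.leaf (ofPN [(1, 1)] [], [1])) (.leaf (ofPN [(9, 1)] [(3, 1), (10, 1)], [3, 9, 10]))) (.leaf (ofPN [(9, 1)] [], [9]))) (.node (.leaf (ofPN [(15, 1)] [(12, 1), (19, 1)], [12, 15, 19])) (.leaf (ofPN [(13, 1)] [], [13]))))
/-- The columns ≡ 2 (mod 4) of `E`. -/ def E_c2 : Tr Col := (.node (.node (.node (.leaf (ofPN [(6, 1)] [(9, 1), (16, 1)], [6, 9, 16])) (.leaf (ofPN [] [(3, 1), (6, 1), (9, 1), (12, 1), (15, 1)], [3, 6, 9, 12, 15]))) (.leaf (ofPN [(10, 1)] [], [10]))) (.node (.leaf (ofPN [(6, 1)] [], [6])) (.leaf (ofPN [] [(7, 1)], [7]))))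
/-- The columns ≡ 3 (mod 4) of `E`. -/ def E_c3 : Tr Col := (.node (.node (.node (.leaf (ofPN [(3, 1)] [], [3])) (.leaf (ofPN [(19, 1)] [], [19]))) (.leaf (ofPN [(1, 1), (3, 1), (6, 1), (9, 1), (10, 1), (12, 2), (13, 1), (15, 1), (16, 1), (19, 1)] [], [1, 3, 6, 9, 10, 12, 13, 15, 16, 19]))) (.node (.leaf (ofPN [(7, 1)] [], [7])) (.leaf (ofPN [(15, 1)] [], [15]))))
/-- E: the column x = the coordinates of [x] in the digit basis (Step 4 of Theorem K1), x = 0, …, N − 1, as a code of length N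
whose digit at the basis point b is the coefficient of [b] (zero at the non-basis positions): the embedded form s∘E. -/
def Etree : Tr Col := (.node (.node E_c0 E_c2) (.node E_c1 E_c3))
/-- The columns ≡ 0 (mod 4) of `h0`. -/ def h0_c0 : Tr Col := (.node (.node (.node (.leaf (ofPN [] [], [])) (.leaf (ofPN [] [], []))) (.leaf (ofPN [] [(1, 1)], [1]))) (.node (.node (.leaf (ofPN [] [(8, 1)], [8])) (.leaf (ofPN [] [(6, 1), (7, 1)], [6, 7]))) (.leaf (ofPN [] [], []))))
/-- The columns ≡ 1 (mod 4) of `h0`. -/ def h0_c1 : Tr Col := (.node (.node (.node (.leaf (ofPN [] [], [])) (.leaf (ofPN [] [(3, 1)], [3]))) (.leaf (ofPN [] [], []))) (.node (.leaf (ofPN [] [(5, 1)], [5])) (.leaf (ofPN [] [], []))))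
/-- The columns ≡ 2 (mod 4) of `h0`. -/ def h0_c2 : Tr Col := (.node (.node (.node (.leaf (ofPN [] [(2, 1)], [2])) (.leaf (ofPN [] [(7, 1)], [7]))) (.leaf (ofPN [] [], []))) (.node (.leaf (ofPN [] [], [])) (.leaf (ofPN [] [(0, 1)], [0]))))
/-- The columns ≡ 3 (mod 4) of `h0`. -/ def h0_c3 : Tr Col := (.node (.node (.node (.leaf (ofPN [] [], [])) (.leaf (ofPN [] [], []))) (.leaf (ofPN [(7, 1), (8, 1)] [(4, 1)], [4, 7, 8]))) (.node (.leaf (ofPN [] [], [])) (.leaf (ofPN [] [], []))))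
/-- h_0 : K_0 → K_1, the columns x = 0, …, N − 1. -/ def h0tree : Tr Col := (.node (.node h0_c0 h0_c2) (.node h0_c1 h0_c3))
/-- The columns ≡ 0 (mod 4) of `h1`. -/ def h1_c0 : Tr Col := (.node (.node (.leaf (ofPN [] [], [])) (.leaf (ofPN [] [], []))) (.leaf (ofPN [] [], [])))
/-- The columns ≡ 1 (mod 4) of `h1`. -/ def h1_c1 : Tr Col := (.node (.node (.leaf (ofPN [] [], [])) (.leaf (ofPN [] [(0, 1)], [0]))) (.leaf (ofPN [] [], [])))
/-- The columns ≡ 2 (mod 4) of `h1`. -/ def h1_c2 : Tr Col := (.node (.leaf (ofPN [] [], [])) (.leaf (ofPN [] [], [])))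
/-- The columns ≡ 3 (mod 4) of `h1`. -/ def h1_c3 : Tr Col := (.node (.leaf (ofPN [] [], [])) (.leaf (ofPN [] [], [])))
/-- h_1 : K_1 → K_2, the columns y = 0, …, dim K_1 − 1. -/ def h1tree : Tr Col := (.node (.node h1_c0 h1_c2) (.node h1_c1 h1_c3))
/-- The columns ≡ 0 (mod 4) of `W`. -/ def W_c0 : Tr Col := (.node (.node (.node (.leaf (ofPN [(0, 1)] [], [0])) (.leaf (ofPN [(10, 1)] [(7, 1), (8, 1)], [7, 8, 10]))) (.leaf (ofPN [] [], []))) (.node (.node (.leaf (ofPN [] [], [])) (.leaf (ofPN [] [], []))) (.leaf (ofPN [(6, 1), (7, 1), (8, 1), (9, 1)] [(1, 1), (11, 1)], [1, 6, 7, 8, 9, 11]))))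
/-- The columns ≡ 1 (mod 4) of `W`. -/ def W_c1 : Tr Col := (.node (.node (.node (.leaf (ofPN [(1, 1), (3, 1), (4, 1), (10, 1)] [(6, 1), (7, 2), (8, 1), (9, 3)], [1, 3, 4, 6, 7, 8, 9, 10])) (.leaf (ofPN [] [], []))) (.leaf (ofPN [(6, 1), (7, 1), (8, 1), (9, 1)] [(1, 1), (10, 1)], [1, 6, 7, 8, 9, 10]))) (.node (.leaf (ofPN [] [], [])) (.leaf (ofPN [(7, 1)] [(4, 1)], [4, 7]))))
/-- The columns ≡ 2 (mod 4) of `W`. -/ def W_c2 : Tr Col := (.node (.node (.node (.leaf (ofPN [] [], [])) (.leaf (ofPN [] [], []))) (.leaf (ofPN [(5, 1), (7, 1), (9, 1), (11, 1)] [(3, 1), (6, 1), (8, 1), (10, 1)], [3, 5, 6, 7, 8, 9, 10, 11]))) (.node (.leaf (ofPN [(9, 1)] [], [9])) (.leaf (ofPN [] [], []))))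
/-- The columns ≡ 3 (mod 4) of `W`. -/ def W_c3 : Tr Col := (.node (.node (.node (.leaf (ofPN [(1, 1), (3, 1), (4, 1), (10, 1)] [(5, 1), (7, 2), (9, 3)], [1, 3, 4, 5, 7, 9, 10])) (.leaf (ofPN [(1, 1)] [(7, 1)], [1, 7]))) (.leaf (ofPN [] [], []))) (.node (.leaf (ofPN [(2, 1)] [], [2])) (.leaf (ofPN [(8, 1)] [], [8]))))
/-- The columns of W by the POINT x = 0, …, N − 1: at a basis point b the column W e_b (a code of length φ(N) in the new basis
α, β, γ), zero at the non-basis points. -/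
def Wtree : Tr Col := (.node (.node W_c0 W_c2) (.node W_c1 W_c3))
/-- The columns ≡ 0 (mod 4) of `Winv`. -/ def Winv_c0 : Tr Col := (.node (.node (.leaf (ofPN [(0, 1)] [], [0])) (.leaf (ofPN [(15, 1)] [], [15]))) (.leaf (ofPN [(3, 1), (6, 1), (10, 1), (12, 1)] [], [3, 6, 10, 12])))
/-- The columns ≡ 1 (mod 4) of `Winv`. -/ def Winv_c1 : Tr Col := (.node (.node (.leaf (ofPN [(3, 1), (6, 1), (10, 1), (12, 1), (13, 1), (19, 1)] [], [3, 6, 10, 12, 13, 19])) (.leaf (ofPN [(6, 1)] [], [6]))) (.leaf (ofPN [(1, 1), (9, 1), (10, 1), (12, 1), (13, 1), (15, 1), (16, 1), (19, 1)] [], [1, 9, 10, 12, 13, 15, 16, 19])))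
/-- The columns ≡ 2 (mod 4) of `Winv`. -/ def Winv_c2 : Tr Col := (.node (.node (.leaf (ofPN [(7, 1)] [], [7])) (.leaf (ofPN [(3, 1), (6, 1), (10, 1), (12, 1), (13, 1), (15, 1), (16, 1)] [], [3, 6, 10, 12, 13, 15, 16]))) (.leaf (ofPN [(3, 1), (9, 1), (10, 1), (12, 1), (13, 1), (16, 1), (19, 1)] [], [3, 9, 10, 12, 13, 16, 19])))
/-- The columns ≡ 3 (mod 4) of `Winv`. -/ def Winv_c3 : Tr Col := (.node (.node (.leaf (ofPN [(1, 1), (6, 2), (9, 1), (13, 1)] [], [1, 6, 9, 13])) (.leaf (ofPN [(3, 1), (6, 1), (9, 1), (10, 1), (13, 1), (15, 1), (16, 1)] [], [3, 6, 9, 10, 13, 15, 16]))) (.leaf (ofPN [(3, 1), (6, 1), (10, 1), (12, 1), (13, 1)] [], [3, 6, 10, 12, 13])))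
/-- The columns of W⁻¹, j = 0, …, φ(N) − 1, in the embedded form (codes of length N supported on the basis points). -/ def Winvtree : Tr Col := (.node (.node Winv_c0 Winv_c2) (.node Winv_c1 Winv_c3))
/-- (a, b, c). -/ def abc : Nat × Nat × Nat := (2, 2, 4)
/-- The zigzags: for each S ⊆ P(N) (by size, then lexicographic), the columns x_k, …, x_0 (x_j ∈ K_j). -/ def zigzags : List (List Nat × List Col) := [([], [(ofPN [(0, 1)] [], [0])]), ([3], [(ofPN [(0, 1)] [], [0]), (ofPN [] [(7, 1)], [7])]), ([7], [(ofPN [(7, 1)] [], [7]), (ofPN [] [(3, 1), (6, 1), (9, 1)], [3, 6, 9])]), ([3, 7], [(ofPN [(0, 1)] [], [0]), (ofPN [(1, 1), (2, 1), (3, 1)] [(8, 1)], [1, 2, 3, 8]), (ofPN [(4, 1), (6, 1)] [(2, 1), (8, 1)], [2, 4, 6, 8])])]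
/-- The inverse mod 2 of the even class matrix (rows = u_S, |S| even, in the order of `zigzags`; columns = the ℤ_+ block). -/ def evenInv : List (List Nat) := [[1, 0], [0, 1]]
/-- The inverse mod 2 of the odd class matrix (the ℤ_− block). -/ def oddInv : List (List Nat) := [[1, 0], [0, 1]]
/-- ρ rows of the row space of the constraint system of D_N in echelon form: (row, its pivot = leading bit), pivots strictly
decreasing. -/
def echRows : List (Nat × Nat) := [(1048578, 20), (524292, 19), (262152, 18), (131088, 17), (65568, 16), (32832, 15), (16512, 14), (8448, 13), (4608, 12), (3072, 11), (1560, 10), (612, 9), (330, 8)]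
/-- Their recipes: the indices of the constraint rows whose XOR is the echelon row. -/ def recipes : List (List Nat) := [[0], [1], [2], [3], [4], [5], [6], [7], [8], [9], [3, 12], [4, 11], [5, 10]]
/-- For every constraint row (in the order of `DNrows`), the indices of the echelon rows whose XOR with it is 0. -/ def redLists : List (List Nat) := [[0], [1], [2], [3], [4], [5], [6], [7], [8], [9], [5, 12], [4, 11], [3, 10], [2, 8, 9, 10], [1, 5, 8, 11], [0, 2, 7, 12], [1, 4, 7, 10, 11, 12], [0, 3, 9, 10, 11, 12]]

/-! ## The checks -/

/-- The column at the point x of M = the matrix of ι on U_N in the digit basis: E([−x]) (embedded form). -/ def Mcol (x : Nat) : Col := Etree.col ((N - x) % N)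
/-- M as a tree by the point. -/ def Mtree : Tr Col := Tr.ofList 24 ((List.range N).map Mcol)
/-- The constraint rows as a tree. -/ def DNtree : Tr Nat := Tr.ofList 24 DNrows
/-- The echelon rows as a tree. -/ def echTree : Tr Nat := Tr.ofList 24 (echRows.map (·.1))
/-- u_S = E x_0 (the embedded form, supported on B). -/ def uS (z : List Nat × List Col) : Col := (mulVec Etree (z.2.getD z.1.length ((0, 0), [])), B)
/-- D = diag(1^a, (−1)^b, J^c) on a column of length φ(N): the β-block negated (its digits exchanged between P and Q), the γ-pairs swapped. -/ def applyD (v : Col) : Col :=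
  let a := abc.1
  let b := abc.2.1
  let maskB := ((1 <<< (64 * b)) - 1) <<< (64 * a)
  let P1 := v.1.1 - (v.1.1 &&& maskB) + (v.1.2 &&& maskB)
  let Q1 := v.1.2 - (v.1.2 &&& maskB) + (v.1.1 &&& maskB)
  let σ : Nat → Nat := fun i => if i < a + b then i else (if (i - (a + b)) % 2 = 0 then i + 1 else i - 1)
  permute σ ((P1, Q1), v.2)
/-- (1 + s·ι) v on K_k, s = ±1. -/ def onePlusIota (k : Nat) (s : Int) (v : Col) : Code :=
  let w := (applyIota k v).1
  if 0 < s then cadd v.1 w else cadd v.1 (w.2, w.1)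
/-- The columns of a tree, in order. -/ def Tr.toList (t : Tr Col) (n : Nat) : List Col := (List.range n).map t.col

/-- THE SUPPORTS: every datum's digits lie within its listed support. -/ def chk_supports : Bool :=
  (Etree.toList N).all suppOK && (h0tree.toList N).all suppOK && (h1tree.toList (dimK 1)).all suppOK && (Wtree.toList N).all suppOK &&
  (Winvtree.toList phiN).all suppOK && zigzags.all (fun z => z.2.all suppOK)
/-- THE BOUNDS: every digit of every datum, of every ∂-column and of every u_S is < 2^20 (no bits outside the mask), and every
list length is ≤ 21. -/
def chk_bounds : Bool :=
  let allD := fun (cols : List Col) (n : Nat) => cols.all (fun c => digitsD c.1.1 n && digitsD c.1.2 n)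
  allD (Etree.toList N) N && allD (h0tree.toList N) (dimK 1) && allD (h1tree.toList (dimK 1)) (dimK 2) && allD (Wtree.toList N) phiN && allD (Winvtree.toList phiN) N &&
  zigzags.all (fun z => (enumFrom 0 z.2).all (fun p => digitsD p.2.1.1 (dimK (z.1.length - p.1)) && digitsD p.2.1.2 (dimK (z.1.length - p.1)))) &&
  (dCols 1).all (fun c => digitsD c.1.1 (dimK 0) && digitsD c.1.2 (dimK 0)) && (dCols 2).all (fun c => digitsD c.1.1 (dimK 1) && digitsD c.1.2 (dimK 1)) && zigzags.all (fun z => digitsD (uS z).1.1 N && digitsD (uS z).1.2 N) &&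
  dimK 0 ≤ 21 && dimK 1 ≤ 21 && dimK 2 ≤ 21 && phiN ≤ 21 && N ≤ 21
/-- The modular inverses, the dimensions, |B_N| = φ(N) = 12. -/ def chk_setup : Bool :=
  (List.zip PE invs).all (fun q => ((N / q.1.1 ^ q.1.2) * q.2) % (q.1.1 ^ q.1.2) = 1) &&
  prodL (PE.map (fun q => q.1 ^ q.2)) = N && dimK 0 = 21 && dimK 1 = 10 && dimK 2 = 1 && lenF B 0 = phiN && phiN = 12 &&
  abc.1 + abc.2.1 + 2 * abc.2.2 = phiN && lenF zigzags 0 = 2 ^ PN.length && PN.length = 2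
/-- (i) E ∂_1 = 0. -/ def chk_i : Bool := (dCols 1).all (fun col => czero (mulVec Etree col))
/-- (ii) sE + ∂_1 h_0 = 1 on K_0. -/ def chk_ii : Bool := (List.range N).all (fun x => cunit (cadd (Etree.col x).1 (mulVec (dTree 1) (h0tree.col x))) x)
/-- (iii) E s = 1: the column of E at a basis point b is e_b. -/ def chk_iii : Bool := B.all (fun b => cunit (Etree.col b).1 b)
/-- (iv) h_0 ∂_1 + ∂_2 h_1 = 1 on K_1. -/ def chk_iv_1 : Bool := (enumFrom 0 (basisK 1)).all (fun p => cunit (cadd (mulVec h0tree (dCol 1 p.2)) (mulVec (dTree 2) (h1tree.col p.1))) p.1)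
/-- (iv) h_1 ∂_2 = 1 on K_2 (the top degree). -/ def chk_iv_2 : Bool := (enumFrom 0 (basisK 2)).all (fun p => cunit (mulVec h1tree (dCol 2 p.2)) p.1)
/-- (v) W·W⁻¹ = 1 and W·M = D·W (the columns of W at the non-basis points are zero). -/ def chk_v : Bool :=
  (List.range phiN).all (fun j => cunit (mulVec Wtree (Winvtree.col j)) j) &&
  B.all (fun b => ceq (mulVec Wtree (Mcol b)) (applyD (Wtree.col b)).1) &&
  (List.range N).all (fun x => inB x || czero (Wtree.col x).1)
/-- (vi-a) the zigzag identities: x_k = e_S and ∂x_j = (1 + s_j ι) x_{j−1}, s_j = (−1)^{k−j}. -/ def zigzagOK (S : List Nat) (xs : List Col) : Bool :=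
  let k := S.length
  xs.length = k + 1 && ceq (xs.getD 0 ((0, 0), [])).1 (eS S) &&
  (List.range k).all (fun t =>
    let j := k - t
    let s : Int := if t % 2 = 0 then 1 else -1
    ceq (mulVec (dTree j) (xs.getD t ((0, 0), []))) (onePlusIota (j - 1) s (xs.getD (t + 1) ((0, 0), []))))
/-- (vi-a) for every S ⊆ P(N). -/ def chk_vi_a : Bool := zigzags.all (fun z => zigzagOK z.1 z.2)
/-- The block coordinates mod 2 of a code: the digits off..off+len−1 of P + Q, mod 2. -/ def blockMod2 (v : Code) (off len : Nat) : List Nat := (List.range len).map (fun t => (digit v.1 (off + t) + digit v.2 (off + t)) % 2)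
/-- (vi-b) ι u_S = (−1)^{|S|} u_S, and the class matrices invertible mod 2. -/ def chk_vi_b : Bool :=
  let a := abc.1
  let b := abc.2.1
  zigzags.all (fun z => let u := uS z; let w := mulVec Mtree u; if z.1.length % 2 = 0 then ceq w u.1 else ceq w (u.1.2, u.1.1)) &&
  (let evens := zigzags.filter (fun z => z.1.length % 2 = 0)
   let odds := zigzags.filter (fun z => z.1.length % 2 = 1)
   let rowsE := evens.map (fun z => blockMod2 (mulVec Wtree (uS z)) 0 a)
   let rowsO := odds.map (fun z => blockMod2 (mulVec Wtree (uS z)) a b)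
   let isInv := fun (rows inv : List (List Nat)) (n : Nat) => (List.range n).all (fun i => (List.range n).all (fun j =>
      ((List.range n).foldl (fun acc t => acc + (rows.getD i []).getD t 0 * (inv.getD t []).getD j 0) 0) % 2 = (if i = j then 1 else 0)))
   lenF evens 0 = a && lenF odds 0 = b && isInv rowsE evenInv a && isInv rowsO oddInv b)
/-- (vii) the echelon rows are XORs of constraint rows (their recipes), their pivots are their leading bits and strictly
decrease (so they are independent: rank ≥ ρ), every constraint row is the XOR of listed echelon rows (rank ≤ ρ), and bit 0 is unused. -/
def chk_vii : Bool :=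
  (List.zip echRows recipes).all (fun p => Nat.beq (xorList DNtree p.2 0) p.1.1) && lenF echRows 0 = lenF recipes 0 &&
  echRows.all pivotOK && strictDesc (echRows.map (·.2)) &&
  (List.zip DNrows redLists).all (fun p => Nat.beq (xorList echTree p.2 p.1) 0) && lenF DNrows 0 = lenF redLists 0 &&
  DNrows.all (fun v => v % 2 = 0)

/-- THE SETUP, THE SUPPORTS AND THE BOUNDS (kernel). -/ theorem setup_ok : (chk_setup && chk_supports && chk_bounds) = true := by decide +kernel
/-- THEOREM K1 AT N = 21 (kernel): (i)–(iv). -/ theorem K1 : (chk_i && chk_ii && chk_iii && chk_iv_1 && chk_iv_2) = true := by decide +kernel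
/-- THEOREM K2 AT N = 21 (kernel): (v) the decomposition with (a, b, c) = (2, 2, 4), a = b = 2^{#P(N)−1}; (vi) the zigzag classes. -/ theorem K2 : (chk_v && chk_vi_a && chk_vi_b && abc.1 = 2 ^ (PN.length - 1) && abc.2.1 = 2 ^ (PN.length - 1)) = true := by decide +kernel
/-- THEOREM C AT N = 21 (kernel): rank = 13, dim D_N = (N − 1) − 13 = 7 = φ(N)/2 + 2^{#P(N)−1} − 1. -/ theorem C : (chk_vii && lenF echRows 0 = 13 && (N - 1) - lenF echRows 0 = phiN / 2 + 2 ^ (PN.length - 1) - 1) = true := by decide +kernel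

end HodgeRepro0.P6KoszulKubert21
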